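import Literature.Probability.Percolation.FiniteEnergy
import Literature.Probability.Percolation.ExteriorConnectionEvents
import Literature.Probability.Percolation.UniquenessInfiniteCluster
import HarnessLib

/-!
# Uniqueness of the infinite cluster from uniform exterior connections
# (Aizenman–Chayes–Chayes–Fröhlich–Russo 1983, proof of Thm. 4.4; Barsky–Grimmett–Newman 1991, Comment 6)

Topic `Literature/Probability/Percolation`.  Bernoulli bond percolation `P_p = bondPercolation G p` on a
locally finite simple graph `G` on a countable vertex type `V` (no symmetry of any kind is assumed).

Aizenman, Chayes, Chayes, Fröhlich and Russo prove uniqueness of the infinite cluster in a slab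
(their Theorem 4.4) by the following mechanism, which is graph-independent and is recorded here in that
generality: exhaust the graph by finite vertex sets `Λ₀ ⊆ Λ₁ ⊆ ⋯`; suppose that for all large `N` any two
vertices `u, v` of the inner vertex boundary of `Λ_N` are joined by a path of open EXTERIOR edges of
`Λ_N` (edges of `G` not having both endpoints in `Λ_N`) with probability at least `a > 0`, uniformly in
`N, u, v`.  Then almost surely there is at most one infinite open cluster.  Proof (ACCFR pp. 46–47,
"by countable subadditivity … it is sufficient to show that the set of configurations for which both
`i` and `j` are connected to infinity … and `i ∉ C(j)` has measure zero … `A = ⋂ A_N` … the conditional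
probability of `A` given that `A_N` occurs obeys `≤ 1 - a³` … Taking the limit `N → ∞`"): for fixed
`x, y` let `A = {|C(x)| = |C(y)| = ∞, x ↮ y}` and `B_N` = "`x` and `y` are joined INSIDE `Λ_N` to the
inner boundary but not to each other"; inside and exterior edge sets are disjoint, hence independent
under the product measure (`bondPercolation_inter_of_disjoint`), and on `B_N` the first boundary vertices
reached from `x` and from `y` are functions of the inside configuration, so
`P(A) ≤ P(B_N ∩ {those two are not joined outside}) ≤ (1 - a) P(B_N)`, while `P(B_N ∖ A) → 0`
(local finiteness: a finite cluster together with its neighbours lies inside `Λ_N` for `N` large);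
hence `P(A) ≤ (1 - a) P(A)`, `P(A) = 0`, and `N ≤ 1` a.s. by `numInfiniteClusters_le_one_iff`.

Barsky–Grimmett–Newman 1991 (Comment 6, p. 116) invoke exactly this argument for half-spaces and
orthants of `ℤ^d`, `d ≥ 3`; the present file is the abstract half, the geometric half (a uniform exterior
connection bound) being supplied by its users.  Vocabulary: the tree's constrained clusters
(`ConstrainedClusters.lean`: `withinGraph`, `openConnVia K x y`, determined by `E(K)`).

* vocabulary (`ExteriorConnectionEvents.lean`): exterior steps `starGraph G Set.univ Λ` (steps of `G`
  not having both endpoints in `Λ`), inner boundary `{u ∈ Λ | ∃ w ∉ Λ, G.Adj u w}`, exit decomposition;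
* `measure_twoInfClusters_notConnected_eq_zero_of_exteriorConn` — the two-point estimate `P(A) = 0`;
* **`ae_numInfiniteClusters_le_one_of_exteriorConn`** — the criterion.

References: M. Aizenman, J. T. Chayes, L. Chayes, J. Fröhlich, L. Russo, *On a sharp transition from
area law to perimeter law in a system of random surfaces*, Comm. Math. Phys. 92 (1983) 19–69, §4,
Thm. 4.4 and its proof (eqs. (4.27)–(4.31)) [AizenmanChayesChayesFrohlichRusso1983]; D. J. Barsky,
G. R. Grimmett, C. M. Newman, Probab. Theory Related Fields 90 (1991) 111–148, Comment 6 p. 116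
[BarskyGrimmettNewman1991].
-/

noncomputable section

namespace Literature.Probability.Percolation

open MeasureTheory SimpleGraph Filter
open scoped ENNReal _root_.Topology

variable {V : Type*}

/-! ### The criterion -/

section Criterion

variable [Countable V] (G : SimpleGraph V) (p : unitInterval)

/-- In `ℝ≥0∞`, `a ≤ c · a` with `c < 1` and `a` finite forces `a = 0`. [folklore] -/
private theorem ennreal_eq_zero_of_le_mul_of_lt_one {a c : ℝ≥0∞} (hc : c < 1) (ha : a ≠ ∞) (h : a ≤ c * a) :
    a = 0 := by
  by_contra h0
  have h1 : a * c < a * 1 := ENNReal.mul_lt_mul_right h0 ha hc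
  rw [mul_one, mul_comm] at h1
  exact absurd h (not_le.2 h1)

variable [G.LocallyFinite]

/-- **The two-point estimate** (ACCFR 1983, proof of Thm. 4.4): under the uniform exterior connection
bound, for any two vertices `x, y` the event "`|C(x)| = ∞`, `|C(y)| = ∞` and `x ↮ y`" is null.
[cite: AizenmanChayesChayesFrohlichRusso1983, Thm. 4.4 proof, eqs. (4.27)–(4.31)] -/
theorem measure_twoInfClusters_notConnected_eq_zero_of_exteriorConn (Λ : ℕ → Set V) (hfin : ∀ N, (Λ N).Finite)
    (hmono : Monotone Λ) (hexh : ∀ v, ∃ N, v ∈ Λ N) {a : ℝ} (ha : 0 < a) (N₀ : ℕ)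
    (hconn : ∀ N, N₀ ≤ N → ∀ u ∈ {u | u ∈ Λ N ∧ ∃ w, w ∉ Λ N ∧ G.Adj u w}, ∀ v ∈ {u | u ∈ Λ N ∧ ∃ w, w ∉ Λ N ∧ G.Adj u w},
      a ≤ (bondPercolation G p).real (openConnVia (starGraph G Set.univ (Λ N)) u v))
    (x y : V) :
    bondPercolation G p {ω | ω ∈ percolatesAt x ∧ ω ∈ percolatesAt y ∧ ¬ (openGraph ω).Reachable x y} = 0 := by
  classical
  set μ := bondPercolation G p with hμ
  set A : Set (BondConfig V) :=
    {ω | ω ∈ percolatesAt x ∧ ω ∈ percolatesAt y ∧ ¬ (openGraph ω).Reachable x y} with hA_def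
  -- notation for the `N`-th stage: inside steps `In N`, exterior steps `Ex N`
  let In : ℕ → SimpleGraph V := fun N => withinGraph G (Λ N)
  let Ex : ℕ → SimpleGraph V := fun N => starGraph G Set.univ (Λ N)
  let RI : ℕ → V → V → Set (BondConfig V) := fun N s u => openConnVia (In N) s u
  -- `B_N`: inside `Λ_N`, `x` and `y` reach the inner boundary but not each other
  let B : ℕ → Set (BondConfig V) := fun N =>
    {ω | ω ∉ RI N x y ∧ (∃ u ∈ {u | u ∈ Λ N ∧ ∃ w, w ∉ Λ N ∧ G.Adj u w}, ω ∈ RI N x u) ∧ (∃ v ∈ {u | u ∈ Λ N ∧ ∃ w, w ∉ Λ N ∧ G.Adj u w}, ω ∈ RI N y v)}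
  -- `D_N`: no boundary vertex reached from `x` is joined outside to one reached from `y`
  let D : ℕ → Set (BondConfig V) := fun N =>
    {ω | ∀ u ∈ {u | u ∈ Λ N ∧ ∃ w, w ∉ Λ N ∧ G.Adj u w}, ∀ v ∈ {u | u ∈ Λ N ∧ ∃ w, w ∉ Λ N ∧ G.Adj u w}, ω ∈ RI N x u → ω ∈ RI N y v →
      ω ∉ openConnVia (Ex N) u v}
  set c : ℝ≥0∞ := ENNReal.ofReal (1 - a) with hc_def
  have hc1 : c < 1 := ENNReal.ofReal_lt_one.2 (by linarith)
  ------------------------------------------------------------------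
  -- Step 1: `μ (B_N ∩ D_N) ≤ c * μ (B_N)` for `N ≥ N₀` (independence of inside and exterior edges).
  ------------------------------------------------------------------
  have hstep1 : ∀ N, N₀ ≤ N → μ (B N ∩ D N) ≤ c * μ (B N) := by
    intro N hN
    -- enumerate the (finite) inner boundary
    have hfinB : ({u | u ∈ Λ N ∧ ∃ w, w ∉ Λ N ∧ G.Adj u w}).Finite := (hfin N).subset fun _ h => h.1
    obtain ⟨L, hL⟩ : ∃ L : List V, ∀ u, u ∈ L ↔ u ∈ {u | u ∈ Λ N ∧ ∃ w, w ∉ Λ N ∧ G.Adj u w} :=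
      ⟨hfinB.toFinset.toList, fun u => by rw [Finset.mem_toList, Set.Finite.mem_toFinset]⟩
    let m := L.length
    let b : ℕ → V := fun i => if h : i < L.length then L[i] else x
    have hb_mem : ∀ i, i < m → b i ∈ {u | u ∈ Λ N ∧ ∃ w, w ∉ Λ N ∧ G.Adj u w} := fun i hi => by
      rw [← hL]
      have hbi : b i = L[i] := dif_pos hi
      rw [hbi]; exact List.getElem_mem hi
    have hb_surj : ∀ u ∈ {u | u ∈ Λ N ∧ ∃ w, w ∉ Λ N ∧ G.Adj u w}, ∃ i, i < m ∧ b i = u := by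
      intro u hu
      obtain ⟨i, hi, rfl⟩ := List.mem_iff_getElem.1 ((hL u).2 hu)
      exact ⟨i, hi, by simp only [b, dif_pos hi]⟩
    -- the pieces: first boundary index reached from `x` is `i`, from `y` is `j`, and `x ↮ y` inside
    let P : ℕ → Set (BondConfig V) := fun i => {ω | ω ∈ RI N x (b i) ∧ ∀ i' < i, ω ∉ RI N x (b i')}
    let Q : ℕ → Set (BondConfig V) := fun j => {ω | ω ∈ RI N y (b j) ∧ ∀ j' < j, ω ∉ RI N y (b j')}
    let K : Set (BondConfig V) := {ω | ω ∉ RI N x y}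
    let PQK : ℕ × ℕ → Set (BondConfig V) := fun ij => P ij.1 ∩ Q ij.2 ∩ K
    let E : ℕ × ℕ → Set (BondConfig V) := fun ij => (openConnVia (Ex N) (b ij.1) (b ij.2))ᶜ
    let I : Finset (ℕ × ℕ) := Finset.range m ×ˢ Finset.range m
    -- every inside event is the preimage of a set under `ω ↦ ω ∩ E(In N)`
    have hPQK_eq : ∀ ij, PQK ij = (fun ω : BondConfig V => ω ∩ (In N).edgeSet) ⁻¹'
        ({η | η ∈ openConn x (b ij.1) ∧ ∀ i' < ij.1, η ∉ openConn x (b i')} ∩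
          {η | η ∈ openConn y (b ij.2) ∧ ∀ j' < ij.2, η ∉ openConn y (b j')} ∩ {η | η ∉ openConn x y}) := by
      intro ij; rfl
    have hPQK_det : ∀ ij, DeterminedBy (PQK ij) (In N).edgeSet := fun ij => by
      rw [hPQK_eq]; exact determinedBy_preimage_inter _ _
    -- measurability of the target sets
    have hmeasT : ∀ (s : V) (n : ℕ), MeasurableSet
        {η : BondConfig V | η ∈ openConn s (b n) ∧ ∀ i' < n, η ∉ openConn s (b i')} := by
      intro s n
      have : {η : BondConfig V | η ∈ openConn s (b n) ∧ ∀ i' < n, η ∉ openConn s (b i')} =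
          openConn s (b n) ∩ ⋂ i' ∈ Set.Iio n, (openConn s (b i'))ᶜ := by
        ext η
        simp only [Set.mem_setOf_eq, Set.mem_inter_iff, Set.mem_iInter, Set.mem_compl_iff, Set.mem_Iio]
      rw [this]
      exact (measurableSet_openConn_holds _ _).inter
        (MeasurableSet.biInter (Set.to_countable _) fun i _ => (measurableSet_openConn_holds _ _).compl)
    have hPQK_meas : ∀ ij, MeasurableSet (PQK ij) := by
      intro ij
      rw [hPQK_eq]
      refine MeasurableSet.preimage ?_ (measurable_inter_const _)
      exact ((hmeasT x ij.1).inter (hmeasT y ij.2)).inter (measurableSet_openConn_holds _ _).compl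
    have hE_det : ∀ ij, DeterminedBy (E ij) (Ex N).edgeSet := fun ij => by
      change DeterminedBy ((fun ω : BondConfig V => ω ∩ (Ex N).edgeSet) ⁻¹' (openConn (b ij.1) (b ij.2))ᶜ) _
      exact determinedBy_preimage_inter _ _
    have hE_meas : ∀ ij, MeasurableSet (E ij) := fun ij => (measurableSet_openConnVia _ _ _).compl
    -- (a) `B_N ∩ D_N ⊆ ⋃_{ij ∈ I} PQK ij ∩ E ij`
    have hcover : B N ∩ D N ⊆ ⋃ ij ∈ I, PQK ij ∩ E ij := by
      rintro ω ⟨⟨hK, ⟨u, hu, hxu⟩, ⟨v, hv, hyv⟩⟩, hD⟩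
      have hexi : ∃ i, i < m ∧ ω ∈ RI N x (b i) := by
        obtain ⟨i, hi, rfl⟩ := hb_surj u hu; exact ⟨i, hi, hxu⟩
      have hexj : ∃ j, j < m ∧ ω ∈ RI N y (b j) := by
        obtain ⟨j, hj, rfl⟩ := hb_surj v hv; exact ⟨j, hj, hyv⟩
      have hi : Nat.find hexi < m ∧ ω ∈ RI N x (b (Nat.find hexi)) := Nat.find_spec hexi
      have hj : Nat.find hexj < m ∧ ω ∈ RI N y (b (Nat.find hexj)) := Nat.find_spec hexj
      refine Set.mem_iUnion₂.2 ⟨(Nat.find hexi, Nat.find hexj),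
        Finset.mem_product.2 ⟨Finset.mem_range.2 hi.1, Finset.mem_range.2 hj.1⟩, ?_⟩
      refine ⟨⟨⟨⟨hi.2, fun i' hi' h' => ?_⟩, ⟨hj.2, fun j' hj' h' => ?_⟩⟩, hK⟩, ?_⟩
      · exact Nat.find_min hexi hi' ⟨hi'.trans hi.1, h'⟩
      · exact Nat.find_min hexj hj' ⟨hj'.trans hj.1, h'⟩
      · exact hD _ (hb_mem _ hi.1) _ (hb_mem _ hj.1) hi.2 hj.2
    -- (b) the pieces `PQK ij`, `ij ∈ I`, are pairwise disjoint and lie in `B_N`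
    have hdisj : Set.PairwiseDisjoint (↑I : Set (ℕ × ℕ)) PQK := by
      intro ij _ ij' _ hne
      rw [Function.onFun, Set.disjoint_left]
      rintro ω ⟨⟨hP, hQ⟩, -⟩ ⟨⟨hP', hQ'⟩, -⟩
      have h1 : ij.1 = ij'.1 := by
        by_contra h
        rcases Nat.lt_or_gt_of_ne h with hlt | hlt
        · exact hP'.2 _ hlt hP.1
        · exact hP.2 _ hlt hP'.1
      have h2 : ij.2 = ij'.2 := by
        by_contra h
        rcases Nat.lt_or_gt_of_ne h with hlt | hlt
        · exact hQ'.2 _ hlt hQ.1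
        · exact hQ.2 _ hlt hQ'.1
      exact hne (Prod.ext h1 h2)
    have hsubB : (⋃ ij ∈ I, PQK ij) ⊆ B N := by
      intro ω hω
      obtain ⟨ij, hij, hω⟩ := Set.mem_iUnion₂.1 hω
      obtain ⟨hi, hj⟩ := Finset.mem_product.1 hij
      exact ⟨hω.2, ⟨b ij.1, hb_mem _ (Finset.mem_range.1 hi), hω.1.1.1⟩,
        ⟨b ij.2, hb_mem _ (Finset.mem_range.1 hj), hω.1.2.1⟩⟩
    -- (c) `μ (E ij) ≤ c` for `ij ∈ I`
    have hEle : ∀ ij ∈ I, μ (E ij) ≤ c := by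
      intro ij hij
      obtain ⟨hi, hj⟩ := Finset.mem_product.1 hij
      have hS := hconn N hN _ (hb_mem _ (Finset.mem_range.1 hi)) _ (hb_mem _ (Finset.mem_range.1 hj))
      have hSm := measurableSet_openConnVia (Ex N) (b ij.1) (b ij.2)
      have hge : ENNReal.ofReal a ≤ μ (openConnVia (Ex N) (b ij.1) (b ij.2)) :=
        (ENNReal.ofReal_le_iff_le_toReal (measure_ne_top _ _)).2 hS
      calc μ (E ij) = 1 - μ (openConnVia (Ex N) (b ij.1) (b ij.2)) := prob_compl_eq_one_sub hSm
        _ ≤ 1 - ENNReal.ofReal a := tsub_le_tsub_left hge _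
        _ = c := by rw [hc_def, ENNReal.ofReal_sub _ ha.le, ENNReal.ofReal_one]
    -- (d) assemble
    calc μ (B N ∩ D N) ≤ μ (⋃ ij ∈ I, PQK ij ∩ E ij) := measure_mono hcover
      _ ≤ ∑ ij ∈ I, μ (PQK ij ∩ E ij) := measure_biUnion_finset_le I _
      _ = ∑ ij ∈ I, μ (PQK ij) * μ (E ij) := by
          refine Finset.sum_congr rfl fun ij _ => ?_
          exact bondPercolation_inter_of_disjoint G p (disjoint_edgeSet_withinGraph_starGraph_univ (Λ N))
            (hPQK_det ij) (hE_det ij) (hPQK_meas ij) (hE_meas ij)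
      _ ≤ ∑ ij ∈ I, μ (PQK ij) * c :=
          Finset.sum_le_sum fun ij hij => mul_le_mul' le_rfl (hEle ij hij)
      _ = c * ∑ ij ∈ I, μ (PQK ij) := by rw [← Finset.sum_mul, mul_comm]
      _ = c * μ (⋃ ij ∈ I, PQK ij) := by rw [measure_biUnion_finset hdisj fun ij _ => hPQK_meas ij]
      _ ≤ c * μ (B N) := mul_le_mul' le_rfl (measure_mono hsubB)
  ------------------------------------------------------------------
  -- Step 2: `A ⊆ B_N ∩ D_N` up to the null set `{ω ⊄ E(G)}`, once `x, y ∈ Λ_N`.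
  ------------------------------------------------------------------
  obtain ⟨N₁, hN₁⟩ := exists_forall_subset_of_finite hmono hexh (Set.toFinite ({x, y} : Set V))
  have hstep2 : ∀ N, N₁ ≤ N → A ∩ {ω | ω ⊆ G.edgeSet} ⊆ B N ∩ D N := by
    intro N hN
    have hx : x ∈ Λ N := hN₁ N hN (by simp)
    have hy : y ∈ Λ N := hN₁ N hN (by simp)
    rintro ω ⟨⟨hpx, hpy, hxy⟩, hωE⟩
    have exitOf : ∀ {s : V}, s ∈ Λ N → ω ∈ percolatesAt s →
        ∃ u ∈ {u | u ∈ Λ N ∧ ∃ w, w ∉ Λ N ∧ G.Adj u w}, ω ∈ RI N s u := by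
      intro s hs hps
      obtain ⟨z, hz, hzΛ⟩ : ∃ z ∈ openCluster ω s, z ∉ Λ N := by
        by_contra h
        push Not at h
        exact hps ((hfin N).subset h)
      exact exists_bdry_openConnVia_withinGraph_of_walk hωE hz.some hs hzΛ
    refine ⟨⟨fun h => hxy (reachable_of_mem_openConnVia h), exitOf hx hpx, exitOf hy hpy⟩, ?_⟩
    intro u _ v _ hxu hyv huv
    exact hxy ((reachable_of_mem_openConnVia hxu).trans
      ((reachable_of_mem_openConnVia huv).trans (reachable_of_mem_openConnVia hyv).symm))
  ------------------------------------------------------------------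
  -- Step 3: `μ (B_N ∖ A) → 0`.
  ------------------------------------------------------------------
  -- three antitone families with empty intersection
  let F : V → ℕ → Set (BondConfig V) := fun s N =>
    {ω | ω ∉ percolatesAt s ∧ ∃ u w, (openGraph ω).Reachable s u ∧ w ∉ Λ N ∧ G.Adj u w}
  let H : ℕ → Set (BondConfig V) := fun N =>
    ({ω | ω ⊆ G.edgeSet} ∩ openConn x y) ∩ (RI N x y)ᶜ
  have hdiff : ∀ N, B N \ A ⊆ F x N ∪ F y N ∪ H N ∪ {ω | ¬ ω ⊆ G.edgeSet} := by
    intro N ω ⟨⟨hK, ⟨u, hu, hxu⟩, ⟨v, hv, hyv⟩⟩, hnA⟩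
    by_cases hωE : ω ⊆ G.edgeSet
    swap
    · exact Or.inr hωE
    left
    by_cases hpx : ω ∈ percolatesAt x
    · by_cases hpy : ω ∈ percolatesAt y
      · have hreach : (openGraph ω).Reachable x y := by
          by_contra h; exact hnA ⟨hpx, hpy, h⟩
        exact Or.inr ⟨⟨hωE, hreach⟩, hK⟩
      · obtain ⟨w, hw, hadj⟩ := hv.2
        exact Or.inl (Or.inr ⟨hpy, v, w, reachable_of_mem_openConnVia hyv, hw, hadj⟩)
    · obtain ⟨w, hw, hadj⟩ := hu.2
      exact Or.inl (Or.inl ⟨hpx, u, w, reachable_of_mem_openConnVia hxu, hw, hadj⟩)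
  -- vanishing of the `F` families
  have hF_tendsto : ∀ s : V, Tendsto (fun N => μ (F s N)) atTop (𝓝 0) := by
    intro s
    have hanti : Antitone (F s) := by
      intro N N' hNN' ω ⟨h1, u, w, h2, h3, h4⟩
      exact ⟨h1, u, w, h2, fun h => h3 (hmono hNN' h), h4⟩
    have hmeas : ∀ N, MeasurableSet (F s N) := by
      intro N
      have : F s N = (percolatesAt s)ᶜ ∩ ⋃ u, ⋃ w, ⋃ (_ : w ∉ Λ N ∧ G.Adj u w), openConn s u := by
        ext ω
        simp only [F, Set.mem_setOf_eq, Set.mem_inter_iff, Set.mem_compl_iff, Set.mem_iUnion, openConn,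
          exists_prop]
        constructor
        · rintro ⟨h1, u, w, h2, h3, h4⟩; exact ⟨h1, u, w, ⟨h3, h4⟩, h2⟩
        · rintro ⟨h1, u, w, ⟨h3, h4⟩, h2⟩; exact ⟨h1, u, w, h2, h3, h4⟩
      rw [this]
      exact (measurableSet_percolatesAt_holds s).compl.inter (MeasurableSet.iUnion fun u =>
        MeasurableSet.iUnion fun w => MeasurableSet.iUnion fun _ => measurableSet_openConn_holds s u)
    have hempty : ⋂ N, F s N = ∅ := by
      ext ω
      simp only [Set.mem_iInter, Set.mem_empty_iff_false, iff_false, not_forall]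
      by_cases hps : ω ∈ percolatesAt s
      · exact ⟨0, fun h => h.1 hps⟩
      · -- the neighbours of the finite cluster form a finite set
        have hCfin : (openCluster ω s).Finite := Set.not_infinite.1 hps
        have hNBfin : {w | ∃ u ∈ openCluster ω s, G.Adj u w}.Finite := by
          have : {w | ∃ u ∈ openCluster ω s, G.Adj u w} = ⋃ u ∈ openCluster ω s, (G.neighborSet u) := by
            ext w; simp [SimpleGraph.mem_neighborSet]
          rw [this]
          exact hCfin.biUnion fun u _ => (G.neighborSet u).toFinite
        obtain ⟨N₂, hN₂⟩ := exists_forall_subset_of_finite hmono hexh hNBfin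
        refine ⟨N₂, fun h => ?_⟩
        obtain ⟨-, u, w, hsu, hw, hadj⟩ := h
        exact hw (hN₂ N₂ le_rfl ⟨u, hsu, hadj⟩)
    have := tendsto_measure_iInter_atTop (μ := μ) (fun N => (hmeas N).nullMeasurableSet) hanti
      ⟨0, measure_ne_top _ _⟩
    rwa [hempty, measure_empty] at this
  have hH_tendsto : Tendsto (fun N => μ (H N)) atTop (𝓝 0) := by
    have hanti : Antitone H := by
      intro N N' hNN' ω ⟨⟨h1, h2⟩, h3⟩
      refine ⟨⟨h1, h2⟩, fun h => h3 ?_⟩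
      exact openConnVia_mono_graph (withinGraph_mono G (hmono hNN')) x y h
    have hmeasE : MeasurableSet {ω : BondConfig V | ω ⊆ G.edgeSet} := by
      have : {ω : BondConfig V | ω ⊆ G.edgeSet} = ⋂ e ∈ (G.edgeSetᶜ : Set (Sym2 V)), {ω | e ∉ ω} := by
        ext ω
        simp only [Set.mem_setOf_eq, Set.mem_iInter, Set.mem_compl_iff]
        exact ⟨fun h e he heω => he (h heω), fun h e heω => by_contra fun he => h e he heω⟩
      rw [this]
      exact MeasurableSet.biInter (Set.to_countable _) fun e _ => (measurableSet_mem e).compl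
    have hmeas : ∀ N, MeasurableSet (H N) := fun N =>
      (hmeasE.inter (measurableSet_openConn_holds x y)).inter (measurableSet_openConnVia _ _ _).compl
    have hempty : ⋂ N, H N = ∅ := by
      ext ω
      simp only [Set.mem_iInter, Set.mem_empty_iff_false, iff_false, not_forall]
      by_cases hωE : ω ⊆ G.edgeSet
      · by_cases hxy : (openGraph ω).Reachable x y
        · obtain ⟨w⟩ := hxy
          obtain ⟨N₂, hN₂⟩ := exists_forall_subset_of_finite hmono hexh
            (Set.Finite.ofFinset w.support.toFinset (fun v => by simp) :
              {v | v ∈ w.support}.Finite)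
          refine ⟨N₂, fun h => h.2 ?_⟩
          exact openConnVia_withinGraph_of_walk hωE w fun v hv => hN₂ N₂ le_rfl hv
        · exact ⟨0, fun h => hxy h.1.2⟩
      · exact ⟨0, fun h => hωE h.1.1⟩
    have := tendsto_measure_iInter_atTop (μ := μ) (fun N => (hmeas N).nullMeasurableSet) hanti
      ⟨0, measure_ne_top _ _⟩
    rwa [hempty, measure_empty] at this
  have hnull : μ {ω | ¬ ω ⊆ G.edgeSet} = 0 := by
    have hae : ∀ᵐ ω ∂μ, ω ⊆ G.edgeSet := ProbabilityTheory.setBernoulli_ae_subset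
    rw [ae_iff] at hae
    exact hae
  have hstep3 : Tendsto (fun N => μ (B N \ A)) atTop (𝓝 0) := by
    have hbound : ∀ N, μ (B N \ A) ≤ μ (F x N) + μ (F y N) + μ (H N) := by
      intro N
      calc μ (B N \ A) ≤ μ (F x N ∪ F y N ∪ H N ∪ {ω | ¬ ω ⊆ G.edgeSet}) := measure_mono (hdiff N)
        _ ≤ μ (F x N ∪ F y N ∪ H N) + μ {ω | ¬ ω ⊆ G.edgeSet} := measure_union_le _ _
        _ = μ (F x N ∪ F y N ∪ H N) := by rw [hnull, add_zero]
        _ ≤ μ (F x N ∪ F y N) + μ (H N) := measure_union_le _ _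
        _ ≤ μ (F x N) + μ (F y N) + μ (H N) := by
            gcongr; exact measure_union_le _ _
    have hlim : Tendsto (fun N => μ (F x N) + μ (F y N) + μ (H N)) atTop (𝓝 0) := by
      have := ((hF_tendsto x).add (hF_tendsto y)).add hH_tendsto
      simpa using this
    exact tendsto_of_tendsto_of_tendsto_of_le_of_le tendsto_const_nhds hlim (fun _ => zero_le) hbound
  ------------------------------------------------------------------
  -- Step 4: `μ A ≤ c (μ A + μ (B_N ∖ A))` for large `N`, hence `μ A ≤ c μ A`, `μ A = 0`.
  ------------------------------------------------------------------
  have hAle : ∀ N, max N₀ N₁ ≤ N → μ A ≤ c * (μ A + μ (B N \ A)) := by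
    intro N hN
    have hN0 : N₀ ≤ N := le_of_max_le_left hN
    have hN1' : N₁ ≤ N := le_of_max_le_right hN
    calc μ A ≤ μ (A ∩ {ω | ω ⊆ G.edgeSet} ∪ {ω | ¬ ω ⊆ G.edgeSet}) :=
          measure_mono fun ω hω => by
            by_cases h : ω ⊆ G.edgeSet
            · exact Or.inl ⟨hω, h⟩
            · exact Or.inr h
      _ ≤ μ (A ∩ {ω | ω ⊆ G.edgeSet}) + μ {ω | ¬ ω ⊆ G.edgeSet} := measure_union_le _ _
      _ = μ (A ∩ {ω | ω ⊆ G.edgeSet}) := by rw [hnull, add_zero]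
      _ ≤ μ (B N ∩ D N) := measure_mono (hstep2 N hN1')
      _ ≤ c * μ (B N) := hstep1 N hN0
      _ ≤ c * (μ A + μ (B N \ A)) := by
          gcongr
          calc μ (B N) ≤ μ (A ∪ B N \ A) := measure_mono fun ω hω => by
                by_cases h : ω ∈ A
                · exact Or.inl h
                · exact Or.inr ⟨hω, h⟩
            _ ≤ μ A + μ (B N \ A) := measure_union_le _ _
  have hlim : Tendsto (fun N => c * (μ A + μ (B N \ A))) atTop (𝓝 (c * (μ A + 0))) :=
    ENNReal.Tendsto.const_mul (tendsto_const_nhds.add hstep3) (Or.inr ENNReal.ofReal_ne_top)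
  rw [add_zero] at hlim
  have hfinal : μ A ≤ c * μ A :=
    ge_of_tendsto hlim (Filter.eventually_atTop.2 ⟨max N₀ N₁, hAle⟩)
  exact ennreal_eq_zero_of_le_mul_of_lt_one hc1 (measure_ne_top _ _) hfinal

/-- **Uniqueness of the infinite cluster from uniform exterior connections** (the mechanism of
Aizenman–Chayes–Chayes–Fröhlich–Russo 1983, Thm. 4.4, on an arbitrary locally finite graph): let
`Λ₀ ⊆ Λ₁ ⊆ ⋯` be finite sets exhausting `V`, and suppose that for some `a > 0` and all `N ≥ N₀`, any two
vertices of the inner vertex boundary of `Λ_N` are joined by OPEN EXTERIOR STEPS of `Λ_N` (steps of `G`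
not having both endpoints in `Λ_N`) with `P_p`-probability at least `a`.  Then `P_p`-almost surely there
is at most one infinite open cluster.
[cite: AizenmanChayesChayesFrohlichRusso1983, Thm. 4.4 (proof); cf. BarskyGrimmettNewman1991 Comment 6 p. 116] -/
theorem ae_numInfiniteClusters_le_one_of_exteriorConn (Λ : ℕ → Set V) (hfin : ∀ N, (Λ N).Finite)
    (hmono : Monotone Λ) (hexh : ∀ v, ∃ N, v ∈ Λ N) {a : ℝ} (ha : 0 < a) (N₀ : ℕ)
    (hconn : ∀ N, N₀ ≤ N → ∀ u ∈ {u | u ∈ Λ N ∧ ∃ w, w ∉ Λ N ∧ G.Adj u w}, ∀ v ∈ {u | u ∈ Λ N ∧ ∃ w, w ∉ Λ N ∧ G.Adj u w},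
      a ≤ (bondPercolation G p).real (openConnVia (starGraph G Set.univ (Λ N)) u v)) :
    ∀ᵐ ω ∂bondPercolation G p, numInfiniteClusters ω ≤ 1 := by
  have h : ∀ x y : V, ∀ᵐ ω ∂bondPercolation G p,
      ¬ (ω ∈ percolatesAt x ∧ ω ∈ percolatesAt y ∧ ¬ (openGraph ω).Reachable x y) := by
    intro x y
    rw [ae_iff]
    simpa only [not_not] using
      measure_twoInfClusters_notConnected_eq_zero_of_exteriorConn G p Λ hfin hmono hexh ha N₀ hconn x y
  have h' : ∀ᵐ ω ∂bondPercolation G p, ∀ x y : V,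
      ¬ (ω ∈ percolatesAt x ∧ ω ∈ percolatesAt y ∧ ¬ (openGraph ω).Reachable x y) := by
    rw [ae_all_iff]; intro x; rw [ae_all_iff]; intro y; exact h x y
  filter_upwards [h'] with ω hω
  rw [numInfiniteClusters_le_one_iff]
  intro x y hx hy
  by_contra hxy
  exact hω x y ⟨hx, hy, hxy⟩

end Criterion

end Literature.Probability.Percolation

end
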